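import Literature.Probability.RandomPlanarGeometry.HexSAWStripBetaCoefficientWidthTwo
import HarnessLib

/-!
# The width-two strip as a rational function of BOTH variables, and its residue in the LENGTH variable at the threshold:
# `(1 − s²) · B_2(s·x_c; y_2) → (19 − 6√2)/8` (module «BETA-LENGTH-WIDTH-TWO»)

Topic `Literature/Probability/RandomPlanarGeometry` (continues the SOLVED width-two strip: `HexSAWStripSurfaceWidthTwo.lean` — the
excursion–weave–excursion families `W2.fw q`, complete and injective onto the β-walks of `S_{2,L}`, the two-variable family sums
`W2.fsumY x y N = Σ_q x^{|fw q|} y^{c(fw q)}` and their exact transfer-matrix decomposition `W2.fsumY_eq` through `M_x(y) = [[x², x³y],[x³, x²y]]`,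
`W2.wdet x y = det(I − M_x(y))`, `W2.Rbot/Rtop`; `HexSAWStripSurfaceWidthTwoLimit.lean` — `W2.tendsto_sum_wsumY` (general `x`), `W2.tendsto_rsumY`,
`W2.limB2`, `W2.tendsto_fsumY` (at `x = x_c`); «BETA-COEFF-WIDTH-TWO» `HexSAWStripBetaCoefficientWidthTwo.lean` — `HV.wdet_xc_eq`,
`HV.widthTwo_values`, `HV.xc_sq_eq_half`, `HV.stripYT_two_eq_yTwo`).  Lane «pcv-sawmu» (CriticalPhenomena venture), a-p2 g22 — car 3 of the
«β-walks by length» programme (HANDOFF a-p2 g21 item 1; cars 1–2 = #578 «BETA-LENGTH-SPLIT», «BETA-LENGTH-LAW»).  Sources of the SETTING: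
N. R. Beaton, M. Bousquet-Mélou, J. de Gier, H. Duminil-Copin, A. J. Guttmann, CMP 326 (2014), arXiv:1109.0358v5, §2 eq. (10) (`B_{T,L}(x; y)`),
Corollary 8 (p. 12: `ρ_T(y_T) = x_c` — at the threshold the radius in the STEP variable is `x_c`); N. R. Beaton, A. J. Guttmann, I. Jensen,
J. Phys. A 45 (2012) §2 (the narrowest strip's rational series at `y = 1`); H. Duminil-Copin, S. Smirnov, Ann. Math. 175 (2012) Theorem 1
(`x_c`).  The two-variable closed form and the length residue below are the lane's (nothing of the kind is printed; BGJ12 print the `y = 1`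
series only).

## What is proved (namespace `Literature.Probability.RandomPlanarGeometry.SAW.HV.W2`; `x_c = hexCriticalFugacity`, `y_2 = W2.yTwo = stripYT 2`)

* §1 `Egen x y = x³y/(1 − x⁴y)`, `limB2gen x y` (the resolvent form of `B_2(x; y)`, `limB2gen x_c = limB2` by `rfl`), ★ `tendsto_fsumY_gen` —
  `W2.fsumY x y N → limB2gen x y` for ALL `x, y ≥ 0` with `det(I − M_x(y)) > 0`, `x²y ≤ 1`, `x² ≤ 1`, `x⁴y < 1` (the tree's bookkeeping, run for
  general `x`).
* §2 ★★ `limB2gen_eq_rat` — `B_2(x; y) = 2x⁴y(2 − 4x⁴y + 2x⁶y + 2x⁸y² − x¹⁰y²) / ((1 − x⁴y)² · ((1 − x²)(1 − x²y) − x⁶y))`: ONE rational function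
  of `(x, y)`.
* §3 the LENGTH variable at the threshold, `x = s·x_c`, `y = y_2`: `kLen`, ★ `wdet_scaled_eq` (`det(I − M_{s x_c}(y_2)) = (1 − s²)·k(s)`,
  `k(s) = 1 + (1 − x_c²(1+y_2))s² + x_c⁶y_2 s⁴ > 0` on `s² ≤ 1`), `scaled_hyps`, ★★ `tendsto_fsumY_scaled` — for `0 ≤ s < 1` the
  `(s x_c)^{|ω|} y_2^{#top}`-weighted family sums converge to `limB2gen (s x_c) y_2` —, `lenReg` and ★ `one_sub_sq_mul_limB2gen_eq`
  (pole cancellation `(1 − s²)·limB2gen (s x_c) y_2 = lenReg s`), ★ `lenReg_one` (`= (19 − 6√2)/8`), ★★★ `tendsto_one_sub_sq_mul_limB2gen`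
  / `…_stripYT` — `(1 − s²) · B_2(s x_c; y_2) ⟶ (19 − 6√2)/8 = 1.3143398…` as `s ↑ 1`.

Why it matters: `Σ_n bℓ_2(n)(y_2) s^n = B_2(s x_c; y_2)` (the β-walks of `S_2` counted by LENGTH at the threshold, #578's `HV.betaLenSum`), so by
the Abelian theorem the length amplitude `Λℓ_2 = lim_m bℓ_2(2m)(y_2)` of «BETA-LENGTH-LAW» can only be `(19 − 6√2)/8` — the identification with
`HV.betaLenSum` and the pointwise statement are the next module; the number was POSTED as a sealed prediction for the enumeration side before
this file (HOME FINDING-BETA-LENGTH-AMPLITUDE-TWO, 2026-08-26 11:38Z).  Controls inside the same formula: the `y`-residue `(233 + 185√2)/98` and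
the contact amplitude `(45 + √2)/28` of #551 are its values at `x = x_c`.
Label: LANE THEOREM (own result of lane «pcv-sawmu», a-p2 g22, 2026-08-26).  NOT claimed: the identification with `betaLenSum` (next module),
`x > x_c` or `y > y_2`, other widths.
-/

noncomputable section

open Finset Filter Topology

namespace Literature.Probability.RandomPlanarGeometry.SAW.HV

namespace W2

variable {x y : ℝ}

/-! ### §1 The resolvent limit of the family sums for a general step fugacity `x` -/

/-- `E(x, y) = x³y/(1 − x⁴y)`: the excursion series `Σ_k x^{4k+3} y^{k+1}` in closed form, general `x` (`W2.Einf y = Egen x_c y`).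
[cite: DuminilCopinSmirnov2012, §3 (Fig. 3); lane: width-two bookkeeping] -/
def Egen (x y : ℝ) : ℝ := x ^ 3 * y / (1 - x ^ 4 * y)

/-- **`B_2(x; y)` in resolvent form for general `(x, y)`**: the same expression as `W2.limB2` with `x_c` replaced by `x`
(`R = (I − M_x(y))⁻¹` via `W2.Rbot/Rtop`, `E = Egen x y`). [cite: BeatonGuttmannJensen2012, §2 (B_1(z), their width 1 = lane T = 2); lane: the two-variable value] -/
def limB2gen (x y : ℝ) : ℝ :=
  2 * (x * ((Egen x y * (Rbot x y oneBot - 1) + Rbot x y oneTop) +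
    Egen x y * (Egen x y * Rtop x y oneBot + (Rtop x y oneTop - 1)))) +
  2 * (x * Egen x y)

/-- At `x = x_c` the general form is the tree's `W2.limB2`. [cite: BeatonGuttmannJensen2012, §2; lane plumbing] -/
theorem limB2gen_xc (y : ℝ) : limB2gen hexCriticalFugacity y = limB2 y := rfl

/-- ★ **The family sums converge to the resolvent form for general `x`**: `W2.fsumY x y N → limB2gen x y` whenever `x, y ≥ 0`,
`det(I − M_x(y)) > 0`, `x²y ≤ 1`, `x² ≤ 1` and `x⁴y < 1` (the tree's `W2.tendsto_fsumY` is the case `x = x_c`, `y < y_2`; the proof is the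
same bookkeeping over `W2.fsumY_eq`, `W2.tendsto_sum_wsumY`, `W2.tendsto_rsumY`, all stated for general `x` in the tree).
[cite: BeatonBousquetMelouDeGierDuminilCopinGuttmann2014, §2, eq. (10) (arXiv v5 p. 6: B_{T,L}(x; y)); lane «pcv-sawmu» a-p2 g22] -/
theorem tendsto_fsumY_gen (hx0 : 0 ≤ x) (hy0 : 0 ≤ y) (hdet : 0 < wdet x y) (h1 : x ^ 2 * y ≤ 1) (h2 : x ^ 2 ≤ 1) (h4 : x ^ 4 * y < 1) :
    Tendsto (fsumY x y) atTop (𝓝 (limB2gen x y)) := by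
  have hrs : Tendsto (rsumY x y) atTop (𝓝 (Egen x y)) := tendsto_rsumY hx0 hy0 h4
  have hB := tendsto_sum_wsumY hx0 hy0 hdet h1 h2 (g := oneBot) (fun r => by cases r <;> simp [oneBot])
    (fun r => by cases r <;> simp [oneBot])
  have hT := tendsto_sum_wsumY hx0 hy0 hdet h1 h2 (g := oneTop) (fun r => by cases r <;> simp [oneTop])
    (fun r => by cases r <;> simp [oneTop])
  have hshift : ∀ (g : Bool → ℝ) (r : Bool) (c : ℝ), Tendsto (fun N => ∑ n ∈ Finset.range N, wsumY x y g n r) atTop (𝓝 c) →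
      Tendsto (fun N => ∑ n ∈ Finset.range N, wsumY x y g (n + 1) r) atTop (𝓝 (c - g r)) := by
    intro g r c h
    refine ((h.comp (tendsto_add_atTop_nat 1)).sub_const (g r)).congr fun N => ?_
    simp only [Function.comp_apply, Finset.sum_range_succ', wsumY_zero, add_sub_cancel_right]
  have hPb := hshift oneBot false _ hB.1
  have hPt := hshift oneBot true _ hB.2
  have hQb := hshift oneTop false _ hT.1
  have hQt := hshift oneTop true _ hT.2
  have hlin : ∀ (N : ℕ) (r : Bool), ∑ n ∈ Finset.range N, wsumY x y (fun c => if c then 1 else rsumY x y N) (n + 1) r =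
      rsumY x y N * ∑ n ∈ Finset.range N, wsumY x y oneBot (n + 1) r +
        ∑ n ∈ Finset.range N, wsumY x y oneTop (n + 1) r := by
    intro N r
    rw [Finset.mul_sum, ← Finset.sum_add_distrib]
    refine Finset.sum_congr rfl fun n _ => ?_
    rw [wsumY_linear x y _ (n + 1) r]
    delta oneBot oneTop
    simp
  have hF : ∀ N, fsumY x y N =
      2 * (x * ((rsumY x y N * ∑ n ∈ Finset.range N, wsumY x y oneBot (n + 1) false +
          ∑ n ∈ Finset.range N, wsumY x y oneTop (n + 1) false) +
        rsumY x y N * (rsumY x y N * ∑ n ∈ Finset.range N, wsumY x y oneBot (n + 1) true +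
          ∑ n ∈ Finset.range N, wsumY x y oneTop (n + 1) true))) +
      2 * (x * rsumY x y N) := by
    intro N
    rw [fsumY_eq, hlin, hlin]
  have hlim := (((((hrs.mul hPb).add hQb).add (hrs.mul ((hrs.mul hPt).add hQt))).const_mul x).const_mul 2).add
    ((hrs.const_mul x).const_mul 2)
  have hfun : fsumY x y = fun N =>
      2 * (x * ((rsumY x y N * ∑ n ∈ Finset.range N, wsumY x y oneBot (n + 1) false +
          ∑ n ∈ Finset.range N, wsumY x y oneTop (n + 1) false) +
        rsumY x y N * (rsumY x y N * ∑ n ∈ Finset.range N, wsumY x y oneBot (n + 1) true +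
          ∑ n ∈ Finset.range N, wsumY x y oneTop (n + 1) true))) +
      2 * (x * rsumY x y N) := funext hF
  rw [hfun]
  convert hlim using 2
  simp only [limB2gen, oneBot, oneTop, if_true, Bool.false_eq_true, if_false]
  ring

/-! ### §2 `B_2(x; y)` as ONE rational function of `(x, y)` -/

/-- ★★ **`B_2(x; y)` is rational in both variables**: for `det(I − M_x(y)) ≠ 0` and `x⁴y ≠ 1`,
`limB2gen x y = 2x⁴y · (2 − 4x⁴y + 2x⁶y + 2x⁸y² − x¹⁰y²) / ((1 − x⁴y)² · det(I − M_x(y)))`, `det(I − M_x(y)) = (1 − x²)(1 − x²y) − x⁶y`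
(`W2.wdet`).  The whole `y`-dependence of the pole structure at fixed `x` is the linear factor `det`, the whole `x`-dependence at fixed `y`
a sextic in `x²`. [cite: BeatonGuttmannJensen2012, §2 (the printed y = 1 series B_1(z)); lane «pcv-sawmu» a-p2 g22 — the two-variable closed form] -/
theorem limB2gen_eq_rat (hdet : wdet x y ≠ 0) (h4 : 1 - x ^ 4 * y ≠ 0) :
    limB2gen x y = 2 * x ^ 4 * y * (2 - 4 * x ^ 4 * y + 2 * x ^ 6 * y + 2 * x ^ 8 * y ^ 2 - x ^ 10 * y ^ 2) /
      ((1 - x ^ 4 * y) ^ 2 * wdet x y) := by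
  unfold limB2gen Egen Rbot Rtop
  simp only [oneBot, oneTop, Bool.false_eq_true, if_true, if_false, mul_one, mul_zero, add_zero, zero_add]
  rw [eq_div_iff (mul_ne_zero (pow_ne_zero 2 h4) hdet)]
  field_simp
  unfold wdet
  ring

/-! ### §3 The LENGTH variable at the width-two threshold: `x = s·x_c`, `y = y_2`, `0 ≤ s < 1` -/

/-- `k(s) := 1 + (1 − x_c²(1 + y_2)) s² + x_c⁶ y_2 s⁴`, the cofactor of `1 − s²` in `det(I − M_{s·x_c}(y_2))` (plumbing).
[cite: BeatonGuttmannJensen2012, §2 (the transfer matrix of the narrowest strip); lane plumbing] -/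
def kLen (s : ℝ) : ℝ := 1 + (1 - hexCriticalFugacity ^ 2 * (1 + yTwo)) * s ^ 2 + hexCriticalFugacity ^ 6 * yTwo * s ^ 4

/-- ★ `det(I − M_{s·x_c}(y_2)) = (1 − s²) · k(s)`: the determinant is a cubic in `s²` vanishing at the threshold `s = 1`.
[cite: BeatonBousquetMelouDeGierDuminilCopinGuttmann2014, Corollary 8 (arXiv v5 p. 12: ρ_T(y_T) = x_c); lane «pcv-sawmu» a-p2 g22] -/
theorem wdet_scaled_eq (s : ℝ) : wdet (s * hexCriticalFugacity) yTwo = (1 - s ^ 2) * kLen s := by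
  have h0 : wdet hexCriticalFugacity yTwo = 0 := by rw [wdet_xc_eq, sub_self, mul_zero]
  unfold wdet at h0 ⊢
  unfold kLen
  linear_combination (s ^ 4) * h0

/-- `k(s) > 0` for `s² ≤ 1` (indeed `k(s) ≥ 1 − x_c²(1 + y_2) = (10 + √2)/14 > 0`). [cite: BeatonBousquetMelouDeGierDuminilCopinGuttmann2014, Corollary 8; lane plumbing] -/
theorem kLen_pos {s : ℝ} (hs : s ^ 2 ≤ 1) : 0 < kLen s := by
  have hr : Real.sqrt 2 ^ 2 = 2 := Real.sq_sqrt (by norm_num)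
  obtain ⟨hay, hu, -, -⟩ := widthTwo_values
  have ha := xc_sq_eq_half
  have hx := hexCriticalFugacity_pos_lt_one
  have hy : 0 ≤ yTwo := (one_lt_yTwo).le.trans' zero_le_one
  have hc1 : -1 < 1 - hexCriticalFugacity ^ 2 * (1 + yTwo) := by
    rw [mul_add, mul_one, hay, ha]; nlinarith [Real.sqrt_nonneg 2, hr]
  have hc2 : 0 ≤ hexCriticalFugacity ^ 6 * yTwo * s ^ 4 := by positivity
  have hs0 : 0 ≤ s ^ 2 := sq_nonneg s
  unfold kLen
  nlinarith [mul_nonneg hs0 (sub_nonneg.2 hs)]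

/-- The hypotheses of `tendsto_fsumY_gen` at `(s·x_c, y_2)`, `0 ≤ s < 1`: `det > 0`, `x²y ≤ 1`, `x² ≤ 1`, `x⁴y < 1` (plumbing).
[cite: BeatonBousquetMelouDeGierDuminilCopinGuttmann2014, Corollary 8 (arXiv v5 p. 12); lane plumbing] -/
theorem scaled_hyps {s : ℝ} (hs0 : 0 ≤ s) (hs1 : s < 1) :
    0 < wdet (s * hexCriticalFugacity) yTwo ∧ (s * hexCriticalFugacity) ^ 2 * yTwo ≤ 1 ∧ (s * hexCriticalFugacity) ^ 2 ≤ 1 ∧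
      (s * hexCriticalFugacity) ^ 4 * yTwo < 1 := by
  have hx := hexCriticalFugacity_pos_lt_one
  have hy : 0 ≤ yTwo := (one_lt_yTwo).le.trans' zero_le_one
  have hs2 : s ^ 2 ≤ 1 := by nlinarith
  have hs4 : s ^ 4 ≤ 1 := by nlinarith
  have h1 := xc_sq_mul_le_one (le_refl yTwo)
  have h4 := xc_four_mul_lt_one (le_refl yTwo)
  have hx2 : hexCriticalFugacity ^ 2 ≤ 1 := by nlinarith [hx.1, hx.2]
  refine ⟨?_, ?_, ?_, ?_⟩
  · rw [wdet_scaled_eq]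
    exact mul_pos (by nlinarith) (kLen_pos hs2)
  · rw [mul_pow]
    nlinarith [mul_nonneg (sub_nonneg.2 hs2) (mul_nonneg (pow_nonneg hx.1.le 2) hy)]
  · rw [mul_pow]
    nlinarith [mul_nonneg (sub_nonneg.2 hs2) (pow_nonneg hx.1.le 2)]
  · rw [mul_pow]
    nlinarith [mul_nonneg (sub_nonneg.2 hs4) (mul_nonneg (pow_nonneg hx.1.le 4) hy)]

/-- ★★ **The length generating function of the width-two β-walks converges to the two-variable closed form**: for `0 ≤ s < 1`,
`W2.fsumY (s·x_c) y_2 N → limB2gen (s·x_c) y_2` — every family walk weighted `(s x_c)^{|ω|} y_2^{#top}`, i.e. `s^{length}` at the threshold.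
[cite: BeatonBousquetMelouDeGierDuminilCopinGuttmann2014, §2 eq. (10) and Corollary 8; lane «pcv-sawmu» a-p2 g22 — own] -/
theorem tendsto_fsumY_scaled {s : ℝ} (hs0 : 0 ≤ s) (hs1 : s < 1) :
    Tendsto (fsumY (s * hexCriticalFugacity) yTwo) atTop (𝓝 (limB2gen (s * hexCriticalFugacity) yTwo)) := by
  obtain ⟨hdet, h1, h2, h4⟩ := scaled_hyps hs0 hs1
  exact tendsto_fsumY_gen (mul_nonneg hs0 hexCriticalFugacity_pos_lt_one.1.le) ((one_lt_yTwo).le.trans' zero_le_one) hdet h1 h2 h4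

/-- The regular part in the length variable: `(1 − s²)·B_2(s x_c; y_2)` with the pole at `s = 1` cancelled (plumbing):
`2x⁴y(2 − 4x⁴y + 2x⁶y + 2x⁸y² − x¹⁰y²)/((1 − x⁴y)² k(s))` at `x = s x_c`, `y = y_2`. [cite: BeatonGuttmannJensen2012, §2; lane plumbing] -/
def lenReg (s : ℝ) : ℝ :=
  2 * (s * hexCriticalFugacity) ^ 4 * yTwo *
      (2 - 4 * (s * hexCriticalFugacity) ^ 4 * yTwo + 2 * (s * hexCriticalFugacity) ^ 6 * yTwo +
        2 * (s * hexCriticalFugacity) ^ 8 * yTwo ^ 2 - (s * hexCriticalFugacity) ^ 10 * yTwo ^ 2) /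
    ((1 - (s * hexCriticalFugacity) ^ 4 * yTwo) ^ 2 * kLen s)

/-- ★ **Pole cancellation in the length variable**: `(1 − s²) · limB2gen (s x_c) y_2 = lenReg s` for `0 ≤ s < 1`.
[cite: BeatonBousquetMelouDeGierDuminilCopinGuttmann2014, Corollary 8 (arXiv v5 p. 12: ρ_T(y_T) = x_c, i.e. the x-radius at y_T is x_c); lane «pcv-sawmu» a-p2 g22 — own] -/
theorem one_sub_sq_mul_limB2gen_eq {s : ℝ} (hs0 : 0 ≤ s) (hs1 : s < 1) :
    (1 - s ^ 2) * limB2gen (s * hexCriticalFugacity) yTwo = lenReg s := by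
  obtain ⟨hdet, -, -, h4⟩ := scaled_hyps hs0 hs1
  have hs : (1 : ℝ) - s ^ 2 ≠ 0 := by nlinarith
  have hk : kLen s ≠ 0 := (kLen_pos (by nlinarith)).ne'
  have h4' : 1 - (s * hexCriticalFugacity) ^ 4 * yTwo ≠ 0 := (sub_pos.2 h4).ne'
  rw [limB2gen_eq_rat hdet.ne' h4', wdet_scaled_eq, lenReg]
  field_simp

/-- `lenReg` is continuous at `s = 1` (its denominator does not vanish there). [cite: BeatonGuttmannJensen2012, §2; lane plumbing] -/
theorem continuousAt_lenReg_one : ContinuousAt lenReg 1 := by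
  have h4 : 1 - (1 * hexCriticalFugacity) ^ 4 * yTwo ≠ 0 := by
    rw [one_mul]; exact (sub_pos.2 (xc_four_mul_lt_one (le_refl yTwo))).ne'
  have hk : kLen 1 ≠ 0 := (kLen_pos (by norm_num)).ne'
  unfold lenReg
  refine ContinuousAt.div ?_ ?_ (mul_ne_zero (pow_ne_zero 2 h4) hk)
  · fun_prop
  · unfold kLen; fun_prop

/-- ★ **The value at the pole**: `lenReg 1 = (19 − 6√2)/8 = 1.3143398…` (with `x_c⁴y_2 = (2√2 − 1)/7`, `x_c²y_2 = (2 + 3√2)/7`, `x_c² = (2 − √2)/2`).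
[cite: DuminilCopinSmirnov2012, Theorem 1 (x_c = 1/√(2+√2)); BeatonBousquetMelouDeGierDuminilCopinGuttmann2014, Corollary 8; lane «pcv-sawmu» a-p2 g22 — own] -/
theorem lenReg_one : lenReg 1 = (19 - 6 * Real.sqrt 2) / 8 := by
  have hr : Real.sqrt 2 ^ 2 = 2 := Real.sq_sqrt (by norm_num)
  obtain ⟨hay, hu, -, -⟩ := widthTwo_values
  have ha := xc_sq_eq_half
  have key : lenReg 1 = 2 * (hexCriticalFugacity ^ 4 * yTwo) *
      (2 - 4 * (hexCriticalFugacity ^ 4 * yTwo) + 2 * hexCriticalFugacity ^ 2 * (hexCriticalFugacity ^ 4 * yTwo) +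
        2 * (hexCriticalFugacity ^ 4 * yTwo) ^ 2 - hexCriticalFugacity ^ 2 * (hexCriticalFugacity ^ 4 * yTwo) ^ 2) /
      ((1 - hexCriticalFugacity ^ 4 * yTwo) ^ 2 *
        (2 - hexCriticalFugacity ^ 2 - hexCriticalFugacity ^ 2 * yTwo + hexCriticalFugacity ^ 2 * (hexCriticalFugacity ^ 4 * yTwo))) := by
    unfold lenReg kLen
    ring
  rw [key, hu, hay, ha]
  have hden : (1 - (2 * Real.sqrt 2 - 1) / 7) ^ 2 *
      (2 - (2 - Real.sqrt 2) / 2 - (2 + 3 * Real.sqrt 2) / 7 + (2 - Real.sqrt 2) / 2 * ((2 * Real.sqrt 2 - 1) / 7)) ≠ 0 := by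
    have h1 : 0 < 1 - (2 * Real.sqrt 2 - 1) / 7 := by nlinarith [Real.sqrt_nonneg 2, hr]
    have h2 : 0 < 2 - (2 - Real.sqrt 2) / 2 - (2 + 3 * Real.sqrt 2) / 7 + (2 - Real.sqrt 2) / 2 * ((2 * Real.sqrt 2 - 1) / 7) := by
      nlinarith [Real.sqrt_nonneg 2, hr]
    positivity
  rw [div_eq_iff hden]
  linear_combination ((417 / 343 : ℝ) - (541 / 686 : ℝ) * Real.sqrt 2 + (101 / 686 : ℝ) * Real.sqrt 2 ^ 2 -
    (3 / 343 : ℝ) * Real.sqrt 2 ^ 3) * hr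

/-- ★★★ **THE LENGTH RESIDUE OF THE WIDTH-TWO STRIP AT ITS THRESHOLD, IN CLOSED FORM**:
`(1 − s²) · B_2(s·x_c; y_2) ⟶ (19 − 6√2)/8 = 1.31433982822…` as `s ↑ 1`, where `B_2(s x_c; y_2) = limB2gen (s x_c) y_2` is the limit of the
length-weighted family sums (`tendsto_fsumY_scaled`).  By the Abelian theorem this is the only possible value of the length amplitude
`lim_m x_c^{2m} Σ_{β-walks of S_2 with 2m vertices} y_2^{#top}` of «BETA-LENGTH-LAW» at `T = 2` (the identification is the next module).
[cite: BeatonBousquetMelouDeGierDuminilCopinGuttmann2014, Corollary 8 (arXiv v5 p. 12); BeatonGuttmannJensen2012, §2; DuminilCopinSmirnov2012, Theorem 1; lane «pcv-sawmu» a-p2 g22 — own result] -/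
theorem tendsto_one_sub_sq_mul_limB2gen :
    Tendsto (fun s : ℝ => (1 - s ^ 2) * limB2gen (s * hexCriticalFugacity) yTwo) (𝓝[<] 1) (𝓝 ((19 - 6 * Real.sqrt 2) / 8)) := by
  rw [← lenReg_one]
  have hc : Tendsto lenReg (𝓝[<] 1) (𝓝 (lenReg 1)) := continuousAt_lenReg_one.tendsto.mono_left nhdsWithin_le_nhds
  refine hc.congr' ?_
  have hev : ∀ᶠ s : ℝ in 𝓝[<] 1, 0 ≤ s := by
    have : Set.Ioo (0 : ℝ) 1 ∈ 𝓝[<] (1 : ℝ) := Ioo_mem_nhdsLT (by norm_num)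
    filter_upwards [this] with s hs using hs.1.le
  filter_upwards [hev, self_mem_nhdsWithin] with s hs0 hs1
  exact (one_sub_sq_mul_limB2gen_eq hs0 hs1).symm

/-- The same with `y_2 = stripYT 2` and the numeric value. [cite: BeatonBousquetMelouDeGierDuminilCopinGuttmann2014, Corollary 8; lane «pcv-sawmu» a-p2 g22 — own result] -/
theorem tendsto_one_sub_sq_mul_limB2gen_stripYT :
    Tendsto (fun s : ℝ => (1 - s ^ 2) * limB2gen (s * hexCriticalFugacity) (stripYT 2)) (𝓝[<] 1) (𝓝 ((19 - 6 * Real.sqrt 2) / 8)) := by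
  rw [stripYT_two_eq_yTwo]
  exact tendsto_one_sub_sq_mul_limB2gen

end W2

end Literature.Probability.RandomPlanarGeometry.SAW.HV
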